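import Literature.AlgebraicTopology.SingularHomology.CohomologyMayerVietorisInjective
import Literature.AlgebraicTopology.SingularHomology.CohomologyHomotopyInvariance
import Literature.AlgebraicTopology.SingularHomology.CohomologyOfPoint
import Literature.AlgebraicTopology.SingularHomology.CohomologyClopenPieces
import Mathlib.Analysis.Convex.Contractible
import Mathlib.Analysis.InnerProductSpace.PiL2
import Mathlib.Geometry.Manifold.ChartedSpace
import HarnessLib

/-!
# A class vanishing near two compact sets meeting in one point vanishes near their union

A. Hatcher, *Algebraic Topology* (2002), §3.1 pp. 203–204 (Mayer–Vietoris) and §3.3 (closed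
manifolds are locally Euclidean). PROOF FILE (theorems only; no definitions, no named facts).
The patching step used to verify Deligne's Prop. 8.2.7 "in Čech form" (the hypothesis `H` of the
tree's `ker_restrictCompl_le_iSup_range_complexGysin_of_pullback`, file
`AlgebraicGeometry/HodgeTheory/ThomGysinClosedImmersion`) for a finite union of smooth curves on
a surface meeting pairwise in a single point: tautness gives, for each curve separately, an open
neighbourhood on which the class dies (`exists_isOpen_map_subsetIncl_eq_zero_of_isClosedImmersion`,
loc. cit.), and the neighbourhoods are patched two at a time across a small ball around the common
point:

* `singularCohomology.map_subsetIncl_eq_zero_of_subset` — restriction to a smaller subset of a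
  class dying on a bigger one dies;
* `singularCohomology.exists_isOpen_union_map_subsetIncl_eq_zero` — **patching**: in a Hausdorff
  space, if `c ∈ H^{p+1}(M; R)` dies on open neighbourhoods `V₁ ⊇ K₁`, `V₂ ⊇ K₂` of two compact
  sets with `K₁ ∩ K₂ ⊆ {P}`, and `P` has an open neighbourhood `B ⊆ V₁ ∩ V₂` with `Hᵖ(B; R) = 0`,
  then `c` dies on an open neighbourhood of `K₁ ∪ K₂`. Proof: `K₁ ∖ B` and `K₂ ∖ B` are disjoint
  compact sets, separated by disjoint opens `U₁`, `U₂`; with `Wⱼ = (Uⱼ ∪ B) ∩ Vⱼ` one has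
  `Kⱼ ⊆ Wⱼ ⊆ Vⱼ` and `W₁ ∩ W₂ = B`, so Mayer–Vietoris for the open cover `{W₁, W₂}` of `W₁ ∪ W₂`
  (`singularCohomology.eq_zero_of_map_subsetIncl_eq_zero`, Hatcher pp. 203–204) kills `c|_{W₁ ∪ W₂}`;
* `singularCohomology.exists_isOpen_subset_isZero_of_chartedSpace` — **small acyclic balls**: on a
  space with an atlas modelled on `EuclideanSpace ℝ (Fin d)`, every point has arbitrarily small
  open neighbourhoods `B` with `Hᵖ(B; R) = 0` for all `p ≠ 0` (chart preimages of Euclidean balls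
  are homeomorphic to the balls, which are convex hence contractible; Hatcher §3.1 p. 201:
  `Hᵖ` of a contractible space is `Hᵖ(pt) = 0`).

## References

* [HatcherAT2002] A. Hatcher, Algebraic Topology, CUP 2002, §3.1 pp. 199, 201, 203–204; §3.3.
-/

noncomputable section

open CategoryTheory Limits Set Topology Filter

universe u

namespace Literature.AlgebraicTopology.SingularHomology

namespace singularCohomology

variable (R : Type u) [CommRing R] {M : Type u} [TopologicalSpace M]

/-! ### Restriction to smaller subsets -/

/-- If a class dies on `↥T` then it dies on `↥S` for every `S ⊆ T` (the restriction factors: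
`↥S → ↥T → M`). [folklore] -/
theorem map_subsetIncl_eq_zero_of_subset {S T : Set M} (hST : S ⊆ T) {q : ℕ}
    (c : singularCohomology R R M q) (hc : map R R (subsetIncl T) q c = 0) :
    map R R (subsetIncl S) q c = 0 := by
  rw [← subsetIncl_comp_inclusion hST, map_comp, ModuleCat.comp_apply, hc, map_zero]

/-- Restriction of a class to `{w : ↥W | w.1 ∈ S}` factors through its restriction to `↥S`:
if `c|_{↥S} = 0` then `(c|_{↥W})|_{\{w | w.1 ∈ S\}} = 0`. [folklore] -/
theorem map_subsetIncl_preimage_val_eq_zero {W S : Set M} {q : ℕ} (c : singularCohomology R R M q)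
    (hc : map R R (subsetIncl S) q c = 0) :
    map R R (subsetIncl {w : ↥W | w.1 ∈ S}) q (map R R (subsetIncl W) q c) = 0 := by
  let e : C(↥({w : ↥W | w.1 ∈ S}), ↥S) :=
    ⟨fun w ↦ ⟨w.1.1, w.2⟩, (continuous_subtype_val.comp continuous_subtype_val).subtype_mk _⟩
  have hfac : (subsetIncl W).comp (subsetIncl {w : ↥W | w.1 ∈ S}) = (subsetIncl S).comp e := rfl
  rw [← ModuleCat.comp_apply, ← map_comp, hfac, map_comp, ModuleCat.comp_apply, hc, map_zero]

/-! ### Patching across a small acyclic neighbourhood of the common point -/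

/-- **Patching neighbourhoods on which a class dies** (Mayer–Vietoris, Hatcher §3.1 pp. 203–204).
In a Hausdorff space `M`, let `K₁`, `K₂` be compact with `K₁ ∩ K₂ ⊆ {P}`, let `c ∈ H^{p+1}(M; R)`
die on open `V₁ ⊇ K₁` and `V₂ ⊇ K₂`, and let `B ∋ P` be open with `B ⊆ V₁ ∩ V₂` and
`Hᵖ(↥B; R) = 0`. Then `c` dies on some open `W ⊇ K₁ ∪ K₂`. (Separate the disjoint compact sets
`Kⱼ ∖ B` by disjoint opens `Uⱼ`; `Wⱼ = (Uⱼ ∪ B) ∩ Vⱼ`, `W₁ ∩ W₂ = B`, `W = W₁ ∪ W₂`.)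
[cite: HatcherAT2002, §3.1 pp. 203–204] -/
theorem exists_isOpen_union_map_subsetIncl_eq_zero [T2Space M] {K₁ K₂ : Set M}
    (hK₁ : IsCompact K₁) (hK₂ : IsCompact K₂) {P : M} (hKK : K₁ ∩ K₂ ⊆ {P}) {p : ℕ}
    (c : singularCohomology R R M (p + 1)) {V₁ V₂ : Set M} (hV₁ : IsOpen V₁) (hV₂ : IsOpen V₂)
    (hKV₁ : K₁ ⊆ V₁) (hKV₂ : K₂ ⊆ V₂) (h₁ : map R R (subsetIncl V₁) (p + 1) c = 0)
    (h₂ : map R R (subsetIncl V₂) (p + 1) c = 0) {B : Set M} (hB : IsOpen B) (hPB : P ∈ B)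
    (hBV : B ⊆ V₁ ∩ V₂) (hZ : IsZero (singularCohomology R R (↥B) p)) :
    ∃ W : Set M, IsOpen W ∧ K₁ ∪ K₂ ⊆ W ∧ map R R (subsetIncl W) (p + 1) c = 0 := by
  -- separate the disjoint compact sets `K₁ ∖ B`, `K₂ ∖ B`
  have hdisj : Disjoint (K₁ \ B) (K₂ \ B) := by
    refine Set.disjoint_left.mpr fun x hx₁ hx₂ ↦ hx₁.2 ?_
    have hx : x ∈ ({P} : Set M) := hKK ⟨hx₁.1, hx₂.1⟩
    rw [Set.mem_singleton_iff.mp hx]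
    exact hPB
  obtain ⟨U₁, U₂, hU₁, hU₂, hKU₁, hKU₂, hUU⟩ :=
    SeparatedNhds.of_isCompact_isCompact (hK₁.diff hB) (hK₂.diff hB) hdisj
  -- the patched neighbourhoods
  set W₁ : Set M := (U₁ ∪ B) ∩ V₁ with hW₁
  set W₂ : Set M := (U₂ ∪ B) ∩ V₂ with hW₂
  have hW₁o : IsOpen W₁ := (hU₁.union hB).inter hV₁
  have hW₂o : IsOpen W₂ := (hU₂.union hB).inter hV₂
  have hKW₁ : K₁ ⊆ W₁ := fun x hx ↦
    ⟨by by_cases hxB : x ∈ B; exacts [Or.inr hxB, Or.inl (hKU₁ ⟨hx, hxB⟩)], hKV₁ hx⟩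
  have hKW₂ : K₂ ⊆ W₂ := fun x hx ↦
    ⟨by by_cases hxB : x ∈ B; exacts [Or.inr hxB, Or.inl (hKU₂ ⟨hx, hxB⟩)], hKV₂ hx⟩
  have hWW : W₁ ∩ W₂ = B := by
    ext x
    constructor
    · rintro ⟨⟨hx₁ | hx₁, -⟩, ⟨hx₂ | hx₂, -⟩⟩
      · exact absurd hx₂ (Set.disjoint_left.mp hUU hx₁)
      exacts [hx₂, hx₁, hx₁]
    · intro hx
      exact ⟨⟨Or.inr hx, (hBV hx).1⟩, ⟨Or.inr hx, (hBV hx).2⟩⟩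
  refine ⟨W₁ ∪ W₂, hW₁o.union hW₂o, Set.union_subset_union hKW₁ hKW₂, ?_⟩
  -- Mayer–Vietoris on `↥(W₁ ∪ W₂)` for the open cover by the traces of `W₁`, `W₂`
  set W : Set M := W₁ ∪ W₂ with hW
  let A₁ : Set ↥W := {w | w.1 ∈ W₁}
  let A₂ : Set ↥W := {w | w.1 ∈ W₂}
  have hA₁ : IsOpen A₁ := hW₁o.preimage continuous_subtype_val
  have hA₂ : IsOpen A₂ := hW₂o.preimage continuous_subtype_val
  have hAA : A₁ ∪ A₂ = univ := Set.eq_univ_of_forall fun w ↦ w.2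
  -- `↥(A₁ ∩ A₂) ≃ₜ ↥B`
  have hmemB : ∀ w : ↥(A₁ ∩ A₂), w.1.1 ∈ B := fun w ↦ by rw [← hWW]; exact w.2
  have hmemWW : ∀ b : ↥B, (b.1 : M) ∈ W₁ ∩ W₂ := fun b ↦ by rw [hWW]; exact b.2
  have hmemW : ∀ b : ↥B, (b.1 : M) ∈ W := fun b ↦ Or.inl (hmemWW b).1
  let e : ↥(A₁ ∩ A₂) ≃ₜ ↥B :=
    { toFun := fun w ↦ ⟨w.1.1, hmemB w⟩
      invFun := fun b ↦ ⟨⟨b.1, hmemW b⟩, hmemWW b⟩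
      left_inv := fun w ↦ rfl
      right_inv := fun b ↦ rfl
      continuous_toFun := (continuous_subtype_val.comp continuous_subtype_val).subtype_mk _
      continuous_invFun := (continuous_subtype_val.subtype_mk _).subtype_mk _ }
  have hZ' : IsZero (singularCohomology R R (↥(A₁ ∩ A₂)) p) := hZ.of_iso (mapIso R R e p).symm
  exact eq_zero_of_map_subsetIncl_eq_zero R hA₁ hA₂ hAA hZ' _
    (map_subsetIncl_preimage_val_eq_zero R c (map_subsetIncl_eq_zero_of_subset R
      (show W₁ ⊆ V₁ from Set.inter_subset_right) c h₁))
    (map_subsetIncl_preimage_val_eq_zero R c (map_subsetIncl_eq_zero_of_subset R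
      (show W₂ ⊆ V₂ from Set.inter_subset_right) c h₂))

/-! ### Small acyclic neighbourhoods on locally Euclidean spaces -/

/-- Positive-degree cohomology of a contractible space vanishes (Hatcher §3.1 p. 201: it is that of
a point, p. 199). [cite: HatcherAT2002, §3.1 pp. 199 and 201] -/
theorem isZero_of_contractibleSpace (S : Type u) [TopologicalSpace S] [ContractibleSpace S] {p : ℕ}
    (hp : p ≠ 0) : IsZero (singularCohomology R R S p) :=
  (singularCochainComplex.isZero_singularCohomology_of_subsingleton' (R := R) (M := R)
    (X := PUnit.{u + 1}) hp).of_iso (isoOfContractible R R S p).symm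

/-- **Small acyclic balls on a locally Euclidean space**: on a space `M` with an atlas modelled
on `EuclideanSpace ℝ (Fin d)`, every neighbourhood `U` of a point `P` contains an open `B ∋ P`
with `Hᵖ(↥B; R) = 0` for all `p ≠ 0` — the chart preimage of a small Euclidean ball around the
image of `P`, homeomorphic to that ball, which is convex hence contractible.
[cite: HatcherAT2002, §3.1 p. 201 and §3.3 p. 231] -/
theorem exists_isOpen_subset_isZero_of_chartedSpace {d : ℕ} [ChartedSpace (EuclideanSpace ℝ (Fin d)) M]
    (P : M) {U : Set M} (hU : U ∈ 𝓝 P) {p : ℕ} (hp : p ≠ 0) :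
    ∃ B : Set M, IsOpen B ∧ P ∈ B ∧ B ⊆ U ∧ IsZero (singularCohomology R R (↥B) p) := by
  obtain ⟨U₀, hU₀U, hU₀, hPU₀⟩ := mem_nhds_iff.mp hU
  set e := chartAt (EuclideanSpace ℝ (Fin d)) P with he
  have hPe : P ∈ e.source := mem_chart_source _ P
  -- a Euclidean ball inside the image of `e.source ∩ U₀`
  have hT : IsOpen (e '' (e.source ∩ U₀)) := e.isOpen_image_source_inter hU₀
  obtain ⟨ε, hε, hball⟩ := Metric.isOpen_iff.mp hT (e P) ⟨P, ⟨hPe, hPU₀⟩, rfl⟩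
  set B : Set M := e.source ∩ e ⁻¹' Metric.ball (e P) ε with hBdef
  have hBo : IsOpen B := e.isOpen_inter_preimage Metric.isOpen_ball
  have hPB : P ∈ B := ⟨hPe, Metric.mem_ball_self hε⟩
  have hBU : B ⊆ U := by
    rintro x ⟨hxs, hxb⟩
    obtain ⟨y, ⟨hys, hyU⟩, hyx⟩ := hball hxb
    have hxy : y = x := e.injOn hys hxs hyx
    exact hU₀U (hxy ▸ hyU)
  -- `↥B ≃ₜ` the ball, which is contractible
  have himage : e '' B = Metric.ball (e P) ε := by
    refine Set.Subset.antisymm ?_ fun z hz ↦ ?_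
    · rintro _ ⟨x, ⟨-, hxb⟩, rfl⟩
      exact hxb
    · obtain ⟨y, ⟨hys, -⟩, rfl⟩ := hball hz
      exact ⟨y, ⟨hys, hz⟩, rfl⟩
  let f : ↥B ≃ₜ ↥(Metric.ball (e P) ε) := e.homeomorphOfImageSubsetSource Set.inter_subset_left himage
  haveI : ContractibleSpace ↥(Metric.ball (e P) ε) :=
    (convex_ball (e P) ε).contractibleSpace ⟨e P, Metric.mem_ball_self hε⟩
  haveI : ContractibleSpace ↥B := f.contractibleSpace_iff.mpr inferInstance
  exact ⟨B, hBo, hPB, hBU, isZero_of_contractibleSpace R (↥B) hp⟩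

end singularCohomology

end Literature.AlgebraicTopology.SingularHomology

end
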